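import Summits.QuantumFields.BalabanUV.Beta.SpineRecursiveInductive
import Summits.QuantumFields.BalabanUV.Beta.E3CoDressedContact

/-!
# `hR` FOR THE RECURSIVELY TYPED WALL FAMILY — CLOSED ON THE S-SIDE: the level-generic contact law `hCT` DISCHARGED at every level by
# an3's `E3CoDressedContact.e3OfK_bref_inl_inl_of_law'`; hence **`hR ⟸ EXACTLY (L4)`** at the pin `cE = Lc⁴`, `cVH = −Lc⁸/2`
# (β sub-cell, row BETA-an2 = BINDER-OWNERS row D1, gen 16; decision (L3-D′))

HONEST FRAMING (cell charter, verbatim): «discharging BetaPertH makes Balaban's UV stability UNCONDITIONAL — a real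
constructive-QFT result; it is NOT the continuum limit and NOT the Clay problem.»  DERIVED cell leaf (pub-balaban β sub-cell, lane
an2 gen 16); no statement of Bałaban's papers is typed here, no `[cite:]` tag, no `Prop` fact; it instantiates no binder of the
β-function wall by itself (the W-side sockets (L4) of `hR` remain hypotheses; the colour pin is displayed, not ruled).  NOT `BetaPertH`;
NOT continuum; NOT Clay.

## What is here ([folklore] instantiation + wiring; `d + 1 = 4`, odd `Lc`, centred root `ρ_c`)

* `bhKStepAt_mf_uniform` / `bhKStepAt_mm_uniform`: the bordered shape of `bhKStepAt 3 ρ Lc j` with the UNIFORM border scale `stepScale 3 Lc j`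
  (`= 1` at `j = 0`); `mmRead_stepProp_eq_inv_wVH_mul`: `mmRead Lc G_j =ff= (wVH (j+1))⁻¹ · bhKStepAt (j+1)` (leaf-10's
  `mmRead_coDressKBmAt_KInvStep` + `bhKStepAt_succ_inl_inl`).
* **`contactLaw_SrecAt`** = `hCT` of `SpineRecursiveInductive` AS A THEOREM: `∀ j, P j → Q j` — an3-g30's level-generic headline
  `E3CoDressedContact.e3OfK_bref_inl_inl_of_law'` at `(K, 𝕄, σ, S, γ, 𝕄⁺, τ) := (G_j, bhKStepAt j, stepScale j, SrecAt j, γ_j, bhKStepAt (j+1), (wVH (j+1))⁻¹)`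
  with `spr`/`refK_coDressKBmAt(_KInvStep)`, `spr_bhKStepAt`, `relInv_coDressKBmAt_KInvStep_bhKStepAt`, `locStencil_SrecAt` BY NAME.
* `hSrC_SrecAt_all`: the (Sr-conj) law of EVERY member of the recursive family from `hn` + the locks alone.
* **`axisReflectionCovariant_flipK_TbalOf_JsRecBmAtOf_ctrC_closed`**: `∀ j, AxisReflectionCovariant (flipK (TbalOf Lc (JsRecBmAtOf …) j))` from
  EXACTLY the W-data, `hn : 2·cVH = −cE·Lc⁴`, the locks `hlock`, and the W-supplier's sockets `X₂`/`hX₂`/`hEX₂`/`hWrC` — NO S-side hypothesis;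
  **`…_closed_bcj`**: at `(cE, cVH) = (Lc⁴, −Lc⁸/2)` (the tree's numerals `wE = stepScale³`; the SAME pin as the Ward binder,
  `WardLocusRecursive.hSd_SrecAt`): **hR ⟸ EXACTLY (L4)**.

UNITS (displayed, not ruled): the one-contact covariance of member `j+1` forces `cE·wE (j+1) = stepScale (j+1)³·Lc⁴` (`locks_of_pin`); at the
tree's provisional `wE` this is `cE = Lc⁴` with `cVH = −Lc⁸/2` by `hn`; the alternative (keep `(cE, cVH) = (2, −Lc⁴)`, re-pin `wE`) is the
units owners' ruling (R45)/C-an2-75(b).  All declarations `[folklore]`; axioms standard.  Provenance: b2b-balaban β sub-cell, unit beta-an2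
gen 16, 2026-08-20 (v1); `E3CoDressedContact` is lineage an3's (gen 30); no existing file touched.
-/

open Finset
open scoped BigOperators
open Literature.MathematicalPhysics.QuantumFieldTheory
open Literature.MathematicalPhysics.QuantumFieldTheory.Balaban1983to89
open Literature.MathematicalPhysics.QuantumFieldTheory.Balaban1983to89.Beta
open ExpKernelCalculus (MKer Decays BiLoc comp VertexFamily VertexFamily₂ shiftK)
open AffineAveraging (box toSite)
open AveragingContoursRooted (ctr ctrOff ctrOff_mem_box)
open PolarizationSign (reflSign AxisReflectionCovariant)
open KernelReflection (refK)
open ResolventReflection (bref Φ)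
open OneStepResolventKernel (Fib LocStencil JetData)
open OneStepKernelFamily (KInvStep vertexOfK TbalOf flipK)
open BalabanStepJetsSucc (mmRead mmRead_inl_inl wE wVH E2)
open Summit.QuantumFields.BalabanUV.Beta.TameKernelCalculus
open Summit.QuantumFields.BalabanUV.Beta.ChartConjugation (conjV conjW)
open Summit.QuantumFields.BalabanUV.Beta.ChartConjugationRelative (RelInv)
open Summit.QuantumFields.BalabanUV.Beta.AxialDressingRooted (coDressKBmAt axEc one_le_of_neZero spr_coDressKBmAt refK_coDressKBmAt_KInvStep
  decays_coDressKBmAt_KInvStep)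
open Summit.QuantumFields.BalabanUV.Beta.BorderedHessian (bhKAt bhKAt_inr_inr diagK ctGen bhKStepAt bhKStepAt_zero bhKStepAt_succ_inl_inl
  stepScale stepScale_ne_zero bhKStepAt_succ_mf bhKStepAt_succ_mm spr_bhKStepAt relInv_coDressKBmAt_KInvStep_bhKStepAt)
open Summit.QuantumFields.BalabanUV.Beta.WardLocusRecursive (SrecAt locStencil_SrecAt)
open Summit.QuantumFields.BalabanUV.Beta.WardLocusInduction (mmRead_coDressKBmAt_KInvStep wVH_eq_stepScale_sq)
open Summit.QuantumFields.BalabanUV.Beta.KernelWardLevels (stepScale_zero)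
open Summit.QuantumFields.BalabanUV.Beta.E3CoDressedContact (e3OfK_bref_inl_inl_of_law')

noncomputable section

namespace Summit.QuantumFields.BalabanUV.Beta.SpineRooted

/-! ## §1 The uniform bordered shape of `bhKStepAt` and the field block of the next Hessian -/

section Shape

variable {Lc : ℕ} [NeZero Lc]

/-- [folklore] Multiplier–field block of `bhKStepAt 3 ρ Lc j` = `stepScale 3 Lc j ·` that of `bhKAt 3 ρ Lc`, uniformly in `j` (`stepScale 0 = 1`). -/
theorem bhKStepAt_mf_uniform (ρ : Fin 4 → ℤ) : ∀ (j : ℕ) (x y : Fin 4 → ℤ) (κ l : Fin 4),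
    bhKStepAt 3 ρ Lc j x y (Sum.inr κ) (Sum.inl l) = stepScale 3 Lc j * bhKAt 3 ρ Lc x y (Sum.inr κ) (Sum.inl l)
  | 0, x, y, κ, l => by rw [bhKStepAt_zero, stepScale_zero, one_mul]
  | j + 1, x, y, κ, l => bhKStepAt_succ_mf j x y κ l

/-- [folklore] Multiplier–multiplier block of `bhKStepAt 3 ρ Lc j` vanishes, uniformly in `j`. -/
theorem bhKStepAt_mm_uniform (ρ : Fin 4 → ℤ) : ∀ (j : ℕ) (x y : Fin 4 → ℤ) (κ l : Fin 4),
    bhKStepAt 3 ρ Lc j x y (Sum.inr κ) (Sum.inr l) = 0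
  | 0, x, y, κ, l => by rw [bhKStepAt_zero, bhKAt_inr_inr]
  | j + 1, x, y, κ, l => bhKStepAt_succ_mm j x y κ l

/-- [folklore] `wVH 3 Lc j ≠ 0`. -/
theorem wVH_ne_zero (j : ℕ) : wVH 3 Lc j ≠ 0 := by
  rw [wVH_eq_stepScale_sq]; exact pow_ne_zero _ (stepScale_ne_zero j)

/-- [folklore] **THE FIELD BLOCK OF THE NEXT STEP HESSIAN**: `mmRead Lc G_j =ff= (wVH (j+1))⁻¹ · bhKStepAt (j+1)` (leaf-10's dictionary
`mmRead Lc G_j = E2 (j+1)` and `bhKStepAt_succ_inl_inl`). -/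
theorem mmRead_stepProp_eq_inv_wVH_mul (ρ : Fin 4 → ℤ) (j : ℕ) (x z : Fin 4 → ℤ) (a b : Fin 4) :
    mmRead Lc (coDressKBmAt ρ Lc (KInvStep (d := 3) Lc j)) x z (Sum.inl a) (Sum.inl b) =
      (wVH 3 Lc (j + 1))⁻¹ * bhKStepAt 3 ρ Lc (j + 1) x z (Sum.inl a) (Sum.inl b) := by
  rw [mmRead_coDressKBmAt_KInvStep, bhKStepAt_succ_inl_inl, ← mul_assoc, inv_mul_cancel₀ (wVH_ne_zero (j + 1)), one_mul]

/-- [folklore] `G_j` is spread (from `decays_coDressKBmAt_KInvStep`). -/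
theorem spr_stepProp {r : Fin 4 → ℕ} (hr : r ∈ box 4 Lc) (j : ℕ) : Spr (coDressKBmAt (toSite r) Lc (KInvStep (d := 3) Lc j)) := by
  obtain ⟨δ, C, hδ, -, hK⟩ := decays_coDressKBmAt_KInvStep (d := 3) hr j
  exact ⟨C, δ, hδ, hK⟩

end Shape

/-! ## §2 The level-generic contact law `hCT` as a theorem (an3's headline instantiated) -/

section Contact

variable {Lc : ℕ} [NeZero Lc]

/-- [folklore] **THE CONTACT LAW OF THE CUBIC SECTOR AT EVERY LEVEL** (`hCT` of `SpineRecursiveInductive`): for every `j`, the (Sr-conj) law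
of `SrecAt … j` against `(bhKStepAt j, γ_j • diagK ctGen)` implies the field–field law of `e3OfK Lc G_j (SrecAt … j)` with contact coefficient
`γ_j / (stepScale j·Lc⁴·wVH (j+1))` against `bhKStepAt (j+1)` — an3-g30's `E3CoDressedContact.e3OfK_bref_inl_inl_of_law'`. -/
theorem contactLaw_SrecAt (hLc : Odd Lc) (cE cVH cΛ : ℝ) (γ : ℕ → ℝ) (j : ℕ)
    (hP : ∀ (α κ : Fin 4) (u : Fin 4 → ℤ),
      SrecAt 3 Lc (toSite (ctrOff 4 Lc)) cE cVH cΛ j κ (bref α κ u) =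
        reflSign α κ • refK (Φ Lc α) (SrecAt 3 Lc (toSite (ctrOff 4 Lc)) cE cVH cΛ j κ u +
          conjV (bhKStepAt 3 (toSite (ctrOff 4 Lc)) Lc j) (γ j • diagK (ctGen 3 α Lc κ u))))
    (α κ' : Fin 4) (u' x z : Fin 4 → ℤ) (a b : Fin 4) :
    e3OfK Lc (coDressKBmAt (toSite (ctrOff 4 Lc)) Lc (KInvStep (d := 3) Lc j)) (SrecAt 3 Lc (toSite (ctrOff 4 Lc)) cE cVH cΛ j) κ'
        (bref α κ' u') x z (Sum.inl a) (Sum.inl b) =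
      reflSign α κ' * ((Φ Lc α).s (Sum.inl a) * (Φ Lc α).s (Sum.inl b) *
        (e3OfK Lc (coDressKBmAt (toSite (ctrOff 4 Lc)) Lc (KInvStep (d := 3) Lc j)) (SrecAt 3 Lc (toSite (ctrOff 4 Lc)) cE cVH cΛ j) κ' u'
            ((Φ Lc α).r (Sum.inl a) x) ((Φ Lc α).r (Sum.inl b) z) (Sum.inl a) (Sum.inl b) +
          γ j / (stepScale 3 Lc j * (Lc : ℝ) ^ 4 * wVH 3 Lc (j + 1)) *
            conjV (bhKStepAt 3 (toSite (ctrOff 4 Lc)) Lc (j + 1)) (diagK (ctGen 3 α Lc κ' u'))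
              ((Φ Lc α).r (Sum.inl a) x) ((Φ Lc α).r (Sum.inl b) z) (Sum.inl a) (Sum.inl b))) := by
  have hL1 : 1 ≤ Lc := hLc.pos
  have hr := ctrOff_mem_box (d := 4) hL1
  obtain ⟨Cs, δs, hδs, hS⟩ := locStencil_SrecAt (d := 3) hL1 hr cE cVH cΛ j
  have h := e3OfK_bref_inl_inl_of_law' (d := 3) (Lc := Lc) (K := coDressKBmAt (toSite (ctrOff 4 Lc)) Lc (KInvStep (d := 3) Lc j))
    (𝕄 := bhKStepAt 3 (toSite (ctrOff 4 Lc)) Lc j) hL1 (spr_stepProp hr j) (refK_coDressKBmAt_KInvStep (d := 3) hLc j α)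
    (spr_bhKStepAt hr j) (relInv_coDressKBmAt_KInvStep_bhKStepAt (d := 3) hr j) (stepScale 3 Lc j) (stepScale_ne_zero j)
    (bhKStepAt_mf_uniform (toSite (ctrOff 4 Lc)) j) (bhKStepAt_mm_uniform (toSite (ctrOff 4 Lc)) j) hS hδs (γ j) (fun κ u => hP α κ u)
    (𝕄' := bhKStepAt 3 (toSite (ctrOff 4 Lc)) Lc (j + 1)) ((wVH 3 Lc (j + 1))⁻¹)
    (fun x' z' a' b' => mmRead_stepProp_eq_inv_wVH_mul (toSite (ctrOff 4 Lc)) j x' z' a' b') κ' u' x z a b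
  have hcoef : γ j * (wVH 3 Lc (j + 1))⁻¹ / (stepScale 3 Lc j * (Lc : ℝ) ^ (3 + 1)) =
      γ j / (stepScale 3 Lc j * (Lc : ℝ) ^ 4 * wVH 3 Lc (j + 1)) := by
    have hw : wVH 3 Lc (j + 1) ≠ 0 := wVH_ne_zero (j + 1)
    rw [div_eq_div_iff (mul_ne_zero (stepScale_ne_zero j) (pow_ne_zero _ (by exact_mod_cast NeZero.ne Lc)))
      (mul_ne_zero (mul_ne_zero (stepScale_ne_zero j) (pow_ne_zero _ (by exact_mod_cast NeZero.ne Lc))) hw)]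
    field_simp
  rw [h, hcoef]

/-- [folklore] **THE (Sr-conj) LAW OF EVERY MEMBER OF THE RECURSIVE FAMILY** from `hn` and the locks ALONE (`hSrC_SrecAt_all_of_contactLaw` with
`hCT := contactLaw_SrecAt`). -/
theorem hSrC_SrecAt_all (hLc : Odd Lc) (cE cVH cΛ : ℝ) (hn : 2 * cVH = -(cE * (Lc : ℝ) ^ 4)) (γ : ℕ → ℝ)
    (hγ : ∀ j, γ j = cVH * wVH 3 Lc j / (stepScale 3 Lc j * (Lc : ℝ) ^ 4))
    (hlock : ∀ j, cE * wE 3 Lc (j + 1) * (γ j / (stepScale 3 Lc j * (Lc : ℝ) ^ 4 * wVH 3 Lc (j + 1))) = γ (j + 1)) :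
    ∀ (j : ℕ) (α κ : Fin 4) (u : Fin 4 → ℤ),
      SrecAt 3 Lc (toSite (ctrOff 4 Lc)) cE cVH cΛ j κ (bref α κ u) =
        reflSign α κ • refK (Φ Lc α) (SrecAt 3 Lc (toSite (ctrOff 4 Lc)) cE cVH cΛ j κ u +
          conjV (bhKStepAt 3 (toSite (ctrOff 4 Lc)) Lc j) (γ j • diagK (ctGen 3 α Lc κ u))) :=
  hSrC_SrecAt_all_of_contactLaw hLc cE cVH cΛ hn γ hγ hlock fun j hP => contactLaw_SrecAt hLc cE cVH cΛ γ j hP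

end Contact

/-! ## §3 The `hR` root, S-side closed -/

section Root

/-- [folklore] **`hR` FOR THE RECURSIVELY TYPED WALL FAMILY, S-SIDE CLOSED**: `∀ j, AxisReflectionCovariant (flipK (TbalOf Lc (JsRecBmAtOf …) j))`
(`d + 1 = 4`, odd `Lc`, centred root) from EXACTLY the W-data (`VertexFamily₂`, (Wt)), `hn : 2·cVH = −cE·Lc⁴`, the units locks `hlock`, and the
W-supplier's sockets `X₂`/`hX₂`/`hEX₂`/`hWrC` (against `bhKStepAt`, contact symbol `γ_j • diagK ctGen`, `γ_j = cVH·wVH j/(stepScale j·Lc⁴)`).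
NO hypothesis on the first-order side is left.  Discharges nothing of the wall by itself ((L4) and the colour pin are the consumer's). -/
theorem axisReflectionCovariant_flipK_TbalOf_JsRecBmAtOf_ctrC_closed {Lc : ℕ} [NeZero Lc] (hLc : Odd Lc) (cE cVH cΛ : ℝ)
    (hn : 2 * cVH = -(cE * (Lc : ℝ) ^ 4))
    (W : ℕ → Fin 4 → (Fin 4 → ℤ) → Fin 4 → (Fin 4 → ℤ) → MKer 4 (Fib 3)) (Cw δw : ℕ → ℝ) (hδw : ∀ j, 0 < δw j)
    (hW : ∀ j, VertexFamily₂ (W j) Lc (Cw j) (δw j))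
    (hWt : ∀ (j : ℕ) (μ : Fin 4) (y : Fin 4 → ℤ) (ν : Fin 4) (y' t : Fin 4 → ℤ),
      W j μ (y + t) ν (y' + t) = shiftK (-((Lc : ℤ) • t)) (W j μ y ν y'))
    (γ : ℕ → ℝ) (hγ : ∀ j, γ j = cVH * wVH 3 Lc j / (stepScale 3 Lc j * (Lc : ℝ) ^ 4))
    (hlock : ∀ j, cE * wE 3 Lc (j + 1) * (γ j / (stepScale 3 Lc j * (Lc : ℝ) ^ 4 * wVH 3 Lc (j + 1))) = γ (j + 1))
    (X₂ : ℕ → Fin 4 → Fin 4 → (Fin 4 → ℤ) → Fin 4 → (Fin 4 → ℤ) → MKer 4 (Fib 3)) (hX₂ : ∀ j α μ y ν y', Loc (X₂ j α μ y ν y'))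
    (hEX₂ : ∀ j α μ y ν y', comp (axEc (toSite (ctrOff 4 Lc)) Lc) (X₂ j α μ y ν y') = comp (X₂ j α μ y ν y') (axEc (toSite (ctrOff 4 Lc)) Lc))
    (hWrC : ∀ (j : ℕ) (α μ : Fin 4) (y : Fin 4 → ℤ) (ν : Fin 4) (y' : Fin 4 → ℤ),
      (JsRec0AtOf (d := 3) hLc.pos (ctrOff_mem_box hLc.pos) cE cVH cΛ W Cw δw hδw hW j).W μ (bref α μ y) ν (bref α ν y') =
        (reflSign α μ * reflSign α ν) • refK (Φ Lc α)
          ((JsRec0AtOf (d := 3) hLc.pos (ctrOff_mem_box hLc.pos) cE cVH cΛ W Cw δw hδw hW j).W μ y ν y' +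
            conjW (bhKStepAt 3 (toSite (ctrOff 4 Lc)) Lc j)
              (vertexOfK (coDressKBmAt (toSite (ctrOff 4 Lc)) Lc (KInvStep (d := 3) Lc j)) Lc
                (JsRec0AtOf (d := 3) hLc.pos (ctrOff_mem_box hLc.pos) cE cVH cΛ W Cw δw hδw hW j).S μ y)
              (vertexOfK (coDressKBmAt (toSite (ctrOff 4 Lc)) Lc (KInvStep (d := 3) Lc j)) Lc
                (JsRec0AtOf (d := 3) hLc.pos (ctrOff_mem_box hLc.pos) cE cVH cΛ W Cw δw hδw hW j).S ν y')
              (vertexOfK (coDressKBmAt (toSite (ctrOff 4 Lc)) Lc (KInvStep (d := 3) Lc j)) Lc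
                (fun κ u => γ j • diagK (ctGen 3 α Lc κ u)) μ y)
              (vertexOfK (coDressKBmAt (toSite (ctrOff 4 Lc)) Lc (KInvStep (d := 3) Lc j)) Lc
                (fun κ u => γ j • diagK (ctGen 3 α Lc κ u)) ν y') (X₂ j α μ y ν y'))) :
    ∀ j : ℕ, AxisReflectionCovariant
      (flipK (TbalOf Lc (JsRecBmAtOf (d := 3) hLc.pos (ctrOff_mem_box hLc.pos) cE cVH cΛ W Cw δw hδw hW) j)) :=
  axisReflectionCovariant_flipK_TbalOf_JsRecBmAtOf_ctrC_inductive hLc cE cVH cΛ hn W Cw δw hδw hW hWt γ hγ hlock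
    (fun j hP => contactLaw_SrecAt hLc cE cVH cΛ γ j hP) X₂ hX₂ hEX₂ hWrC

/-- [folklore] **`hR` AT THE PIN `(cE, cVH) = (Lc⁴, −Lc⁸/2)` ⟸ EXACTLY THE W-SIDE (L4)** — the tree's numerals `wE = stepScale³`; `hn`, the
locks and every first-order socket discharged; the same pin as the Ward binder's `WardLocusRecursive.hSd_SrecAt`.  What is left of `hR`
for the recursive wall literal: the W-data's block-translation covariance (Wt) and the W-supplier's conjugated second-order law `hWrC` with its
table contacts `X₂` (localised, commuting with `axEc`). -/
theorem axisReflectionCovariant_flipK_TbalOf_JsRecBmAtOf_ctrC_closed_bcj {Lc : ℕ} [NeZero Lc] (hLc : Odd Lc) (cΛ : ℝ)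
    (W : ℕ → Fin 4 → (Fin 4 → ℤ) → Fin 4 → (Fin 4 → ℤ) → MKer 4 (Fib 3)) (Cw δw : ℕ → ℝ) (hδw : ∀ j, 0 < δw j)
    (hW : ∀ j, VertexFamily₂ (W j) Lc (Cw j) (δw j))
    (hWt : ∀ (j : ℕ) (μ : Fin 4) (y : Fin 4 → ℤ) (ν : Fin 4) (y' t : Fin 4 → ℤ),
      W j μ (y + t) ν (y' + t) = shiftK (-((Lc : ℤ) • t)) (W j μ y ν y'))
    (γ : ℕ → ℝ) (hγ : ∀ j, γ j = -((Lc : ℝ) ^ 8 / 2) * wVH 3 Lc j / (stepScale 3 Lc j * (Lc : ℝ) ^ 4))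
    (X₂ : ℕ → Fin 4 → Fin 4 → (Fin 4 → ℤ) → Fin 4 → (Fin 4 → ℤ) → MKer 4 (Fib 3)) (hX₂ : ∀ j α μ y ν y', Loc (X₂ j α μ y ν y'))
    (hEX₂ : ∀ j α μ y ν y', comp (axEc (toSite (ctrOff 4 Lc)) Lc) (X₂ j α μ y ν y') = comp (X₂ j α μ y ν y') (axEc (toSite (ctrOff 4 Lc)) Lc))
    (hWrC : ∀ (j : ℕ) (α μ : Fin 4) (y : Fin 4 → ℤ) (ν : Fin 4) (y' : Fin 4 → ℤ),
      (JsRec0AtOf (d := 3) hLc.pos (ctrOff_mem_box hLc.pos) ((Lc : ℝ) ^ 4) (-((Lc : ℝ) ^ 8 / 2)) cΛ W Cw δw hδw hW j).W μ (bref α μ y) ν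
          (bref α ν y') =
        (reflSign α μ * reflSign α ν) • refK (Φ Lc α)
          ((JsRec0AtOf (d := 3) hLc.pos (ctrOff_mem_box hLc.pos) ((Lc : ℝ) ^ 4) (-((Lc : ℝ) ^ 8 / 2)) cΛ W Cw δw hδw hW j).W μ y ν y' +
            conjW (bhKStepAt 3 (toSite (ctrOff 4 Lc)) Lc j)
              (vertexOfK (coDressKBmAt (toSite (ctrOff 4 Lc)) Lc (KInvStep (d := 3) Lc j)) Lc
                (JsRec0AtOf (d := 3) hLc.pos (ctrOff_mem_box hLc.pos) ((Lc : ℝ) ^ 4) (-((Lc : ℝ) ^ 8 / 2)) cΛ W Cw δw hδw hW j).S μ y)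
              (vertexOfK (coDressKBmAt (toSite (ctrOff 4 Lc)) Lc (KInvStep (d := 3) Lc j)) Lc
                (JsRec0AtOf (d := 3) hLc.pos (ctrOff_mem_box hLc.pos) ((Lc : ℝ) ^ 4) (-((Lc : ℝ) ^ 8 / 2)) cΛ W Cw δw hδw hW j).S ν y')
              (vertexOfK (coDressKBmAt (toSite (ctrOff 4 Lc)) Lc (KInvStep (d := 3) Lc j)) Lc
                (fun κ u => γ j • diagK (ctGen 3 α Lc κ u)) μ y)
              (vertexOfK (coDressKBmAt (toSite (ctrOff 4 Lc)) Lc (KInvStep (d := 3) Lc j)) Lc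
                (fun κ u => γ j • diagK (ctGen 3 α Lc κ u)) ν y') (X₂ j α μ y ν y'))) :
    ∀ j : ℕ, AxisReflectionCovariant
      (flipK (TbalOf Lc (JsRecBmAtOf (d := 3) hLc.pos (ctrOff_mem_box hLc.pos) ((Lc : ℝ) ^ 4) (-((Lc : ℝ) ^ 8 / 2)) cΛ W Cw δw hδw hW) j)) :=
  axisReflectionCovariant_flipK_TbalOf_JsRecBmAtOf_ctrC_inductive_bcj hLc cΛ W Cw δw hδw hW hWt γ hγ
    (fun j hP => contactLaw_SrecAt hLc ((Lc : ℝ) ^ 4) (-((Lc : ℝ) ^ 8 / 2)) cΛ γ j hP) X₂ hX₂ hEX₂ hWrC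

end Root

end Summit.QuantumFields.BalabanUV.Beta.SpineRooted

end
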